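import Summits.CriticalPhenomena.PercolationContinuityZ3.Theorems.PercNearOneGluingNoHeavyQuantFarTreeRowOfThree
import HarnessLib

/-!
# QUANT lane R8, T-DEC: the GATE MOVE — `SDECConvClosed` (hence `TreeBuiltDEC`, `TreeDEC`, `FarTreeRow`) follows from `ConvClosedT` and
# ONE single-layer statement `LawDec.GateMove` ("the law of `ξX₁ + X₂` is DEC(j) ⟹ the law of `ξ(X₁ + X₂)` is DEC(j)"), replacing leg (III)

builds on p205010 (kernel theorem, internal audit signed; external expert review pending)

Statement + support file (`--supports stmt-CriticalPhenomena-4575`), QUANT lane typer seat prim-quant-stmt (gen 26), rung R8 of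
`run/shared/lean/prim/quant/LADDER.md`.  One `@[conjecture]`, theorems with standard axioms, no sorries.  Continues census-2 g53's
`…QuantSDEC` (`SDECConvClosed`), lead g22's `…QuantSliceConeForm` (`ConvClosedT`), lead g24's `…QuantFarTreeRowOfThree`
(`convClosedT_of_two : WindowAtomDecomposition → ConvClosedTResidue → ConvClosedT`) and typer g25's `…QuantGatedConvReduction`.

THE OBSERVATION (typer g26).  For `ξ ~ Bernoulli(q)` independent of `X₁ ~ μ₁`, `X₂ ~ μ₂`, the gated convolution `gate_q(μ₁ ∗ μ₂)` is the law
of `ξ(X₁ + X₂)`, while `Λ := (gate_q μ₁) ∗ μ₂` is the law of `ξX₁ + X₂` — a PLAIN convolution, DEC at every layer by `ConvClosedT` as soon as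
`gate_q μ₁` and `μ₂` are (floor `q·x`).  The two laws differ by a MOVE: `gate_q(μ₁ ∗ μ₂) = Λ + (1−q)·(δ₀ − μ₂)` — the `(1−q)`-copy of `μ₂`
(the event `ξ = 0`) collapses to `0`, and the mean drops by `(1−q)·mean μ₂`.  **CONJECTURE `LawDec.GateMove` (GM′)**: for top-affordable
SDEC probability laws (`x·Mᵢ ≤ mean μᵢ`, `SDEC x Mᵢ μᵢ`), at ONE AND THE SAME LAYER `j`, `Λ ∈ D_{qx}(q·T₁ + T₂, j) ⟹ gate_q(μ₁ ∗ μ₂) ∈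
D_{qx}(q·(T₁ + T₂), j)`.  HENCE (`sdecConvClosed_of_convClosedT_of_gateMove`): **`ConvClosedT ∧ GateMove ⟹ SDECConvClosed`** (and given
`ConvClosedT` the converse is trivial, so GM′ is exactly the gate interaction, isolated as a one-layer move; no empty-free reduction, no
Conjecture E needed), and `WindowAtomDecomposition ∧ ConvClosedTResidue ∧ GateMove ⟹ SDECConvClosed, TreeBuiltDEC, TreeDEC, FarTreeRow`.
For `μ₂ = δ₁` with the shifted flow the move is the one-layer gated-shift theorem (`…QuantGatedShiftOneLayer`, `flowAtT_gatedShift_succ`).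
EVIDENCE AND NON-EVIDENCE (exact, typer g26 seat folder `explore/gm_rand.py`, `pm_rand.py`, `pm_rays.py`, `pm_dualscan.py`, `move_test.py`; `μ₁`
over the EXTREME RAYS of the single-layer hypothesis cone by exact double description, conclusion by exact LP):  (1) WITHOUT the SDEC hypotheses
the move is FALSE: 83 / 1 157 562 ray tests (M₂ ≥ 6), every counterexample with a non-DEC second factor `μ₂ = {1: p, M₂: 1−p}` — e.g. `μ₁ = δ₁`,
`μ₂ = {1: 1/5, 6: 4/5}`, `x = 5/6`, `q = 3/4`, `j = 3`: `Λ = {1:1/20, 2:3/20, 6:1/5, 7:3/5}` is DEC(3) at target `23/4` but `{0:1/4, 2:3/20, 7:3/5}`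
is not DEC(3) at `9/2` (served `9/10`); and the bare move "mass `c` from an atom `a` to `0`, target `−a·c`" is false for arbitrary laws
(140 / 14 847, exactly when `a` is a loaded absorber).  (2) WITH `μ₂` DEC at every layer at `x` (the regime of GM′; `μ₁` free or with `gate_q μ₁` DEC at every layer): 459 772 ray tests / 0
failures (M₁ ≤ 8, M₂ ≤ 9, supports ≤ 4 and ≤ 5, `q ∈ {1/4, …, 99/100}`, floors at and below `min Tᵢ/Mᵢ`); the blob sub-family `μ₂ = {0, a; g}`, `g ≥ x` (always DEC): 357 633 ray tests / 0 (M ≤ 8, a ≤ 4); Farkas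
structure of the blob family (M ≤ 4, q ≤ 23/24): every conclusion facet = the mean identity alone (1 249 335) or ONE hypothesis facet ± the mean
(462).  (3) The one-layer form of Conjecture E with layers `(j−1, j−1)` is FALSE (81 / 531 166), its cross-layer form (ν₁ at `{j−h}`, ν₂ at `{j−k}`)
has 0 / 1 083 k.  HONEST STATUS: `GateMove`, `ConvClosedT`, `SDECConvClosed`, `TreeBuiltDEC`, `TreeDEC`, `FarTreeRow` OPEN; `GatedShiftDEC` is a
theorem (`…QuantGatedShiftDECHolds`).

* `LawDec.GateMove` (`@[conjecture]`, GM′).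
* **`LawDec.sdecConvClosed_of_convClosedT_of_gateMove : ConvClosedT → GateMove → SDECConvClosed`.**
* `LawDec.sdecConvClosed_of_two_gateMove`, `treeBuiltDEC_of_two_gateMove`, `Quant.treeDEC_of_two_gateMove`, **`Quant.farTreeRow_of_two_gateMove :
  WindowAtomDecomposition → ConvClosedTResidue → GateMove → FarTreeRow`**.

[this work]; `SDECConvClosed`: prim-quant-census-2 g53; `ConvClosedT`: lead g22; (I)/(II): lead g24–g25, census-1/2 (this lane).  The gluing
rows served [cite: KozmaNitzan2024, Conjecture 3 (p. 15)]; product measure [cite: Grimmett1999, §1.3 p. 10].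
-/

noncomputable section

namespace Summit.CriticalPhenomena.PercolationContinuityZ3.Theorems

namespace Quant

open Finset

namespace LawDec

/-! ### Conjecture GM -/

/-- **CONJECTURE GM′ (THE GATE MOVE FOR SDEC FACTORS; typer g26).**  For a floor `0 < x < 1`, a gate `0 < q ≤ 1`, probability laws `μ₁` on
`{0..M₁}`, `μ₂` on `{0..M₂}` (nonnegative, vanishing above the top, mass 1, top-affordable `x·Mᵢ ≤ mean μᵢ`) that are BOTH SDEC at `x`, and a
layer `j < M₁ + M₂`: if the plain convolution `(gate_q μ₁) ∗ μ₂` (law of `ξX₁ + X₂`) is DEC(j) at floor `q·x` and target `q·T₁ + T₂` (`Tᵢ`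
the means), then the gated convolution `gate_q(μ₁ ∗ μ₂)` (law of `ξ(X₁ + X₂)`) is DEC(j) at floor `q·x` and target `q·(T₁ + T₂)` — at the
SAME layer.  The two laws differ by `(1−q)·(δ₀ − μ₂)`: the `(1−q)`-copy of `μ₂` collapses to `0` and the target drops by `(1−q)·T₂`.
Given `ConvClosedT` this is EQUIVALENT to `SDECConvClosed` (`sdecConvClosed_of_convClosedT_of_gateMove`; the converse is trivial), i.e. it
isolates the gate interaction as a one-layer move.  WITHOUT the SDEC hypotheses the move is FALSE (typer g26: 83 / 1 157 562 exact ray tests,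
every counterexample with a non-DEC `μ₂ = {1: p, M₂: 1−p}`, e.g. `μ₁ = δ₁`, `μ₂ = {1: 1/5, 6: 4/5}`, `x = 5/6`, `q = 3/4`, `j = 3`).
EVIDENCE for GM′: file header (459 772 exact extreme-ray tests / 0 with `μ₂` DEC at every layer; 357 633 / 0 for blob factors).
builds on p205010 (kernel theorem, internal audit signed; external expert review pending). [this work] [status: open] -/
@[conjecture] def GateMove : Prop :=
  ∀ (x q : ℝ) (M₁ M₂ j : ℕ) (μ₁ μ₂ : ℕ → ℝ),
    0 < x → x < 1 → 0 < q → q ≤ 1 →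
    (∀ h, 0 ≤ μ₁ h) → (∀ h, M₁ < h → μ₁ h = 0) → (∑ h ∈ Finset.range (M₁ + 1), μ₁ h = 1) →
    x * (M₁ : ℝ) ≤ ∑ h ∈ Finset.range (M₁ + 1), (h : ℝ) * μ₁ h →
    (∀ h, 0 ≤ μ₂ h) → (∀ h, M₂ < h → μ₂ h = 0) → (∑ h ∈ Finset.range (M₂ + 1), μ₂ h = 1) →
    x * (M₂ : ℝ) ≤ ∑ h ∈ Finset.range (M₂ + 1), (h : ℝ) * μ₂ h →
    SDEC x M₁ μ₁ → SDEC x M₂ μ₂ →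
    j < M₁ + M₂ →
    DECAtT (q * x) (q * (∑ h ∈ Finset.range (M₁ + 1), (h : ℝ) * μ₁ h) + ∑ h ∈ Finset.range (M₂ + 1), (h : ℝ) * μ₂ h) j (M₁ + M₂)
      (lconv M₁ M₂ (gate μ₁ q) μ₂) →
    DECAtT (q * x) (q * ((∑ h ∈ Finset.range (M₁ + 1), (h : ℝ) * μ₁ h) + ∑ h ∈ Finset.range (M₂ + 1), (h : ℝ) * μ₂ h)) j (M₁ + M₂)
      (gate (lconv M₁ M₂ μ₁ μ₂) q)

/-! ### The reduction -/

/-- **`ConvClosedT ∧ GateMove ⟹ SDECConvClosed`.**  For SDEC factors at floor `x` and a gate `q`: `gate_q μ₁` is DEC at every layer at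
floor `q·x` (SDEC at gate `q`; layers `≥ M₁` by Theorem A), `μ₂` is DEC at every layer at floor `x` (SDEC at gate `1`) hence at `q·x`
(`decAt_mono_floor`), so `ConvClosedT` makes `(gate_q μ₁) ∗ μ₂` DEC(j) at `q·T₁ + T₂`, and `GateMove` turns it into
`gate_q(μ₁ ∗ μ₂)` DEC(j) at its mean `q·(T₁ + T₂)`. [this work] -/
theorem sdecConvClosed_of_convClosedT_of_gateMove (hC : ConvClosedT) (hG : GateMove) : SDECConvClosed := by
  intro x M₁ M₂ μ₁ μ₂ hx0 hx1 h10 h1M h11 hta1 h20 h2M h21 hta2 hS1 hS2 q hq0 hq1 j hj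
  have hqx0 : 0 < q * x := mul_pos hq0 hx0
  have hqx1 : q * x < 1 := by nlinarith
  have hqxx : q * x ≤ x := by nlinarith
  rw [decAt_iff_decAtT, sum_mul_gate, sum_mul_lconv M₁ M₂ μ₁ μ₂ h11 h21]
  refine hG x q M₁ M₂ j μ₁ μ₂ hx0 hx1 hq0 hq1 h10 h1M h11 hta1 h20 h2M h21 hta2 hS1 hS2 hj ?_
  obtain ⟨n10, n1M, n11⟩ := gate_laws M₁ μ₁ q hq0.le hq1 h10 h1M h11
  have nmean : ∑ h ∈ Finset.range (M₁ + 1), (h : ℝ) * gate μ₁ q h = q * ∑ h ∈ Finset.range (M₁ + 1), (h : ℝ) * μ₁ h :=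
    sum_mul_gate μ₁ q M₁
  refine hC (q * x) _ _ M₁ M₂ j (gate μ₁ q) μ₂ hqx0 hqx1 n10 n1M n11 h20 h2M h21 hj ?_ ?_
  · -- the gated factor at floor `q·x`
    intro j'' _ _
    rw [← nmean]
    refine (decAt_iff_decAtT (q * x) j'' M₁ (gate μ₁ q)).1 ?_
    by_cases hj'' : j'' < M₁
    · exact hS1 q hq0 hq1 j'' hj''
    · refine decAt_of_top_le M₁ (gate μ₁ q) n10 n1M n11 (q * x) hqx1 (fun h hh => ?_) j'' (not_lt.1 hj'')
      have hhM : h ≤ M₁ := by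
        by_contra hc
        exact absurd (n1M h (not_le.1 hc)) (ne_of_gt hh)
      rw [nmean]
      have h1 : q * x * (h : ℝ) ≤ q * x * (M₁ : ℝ) := mul_le_mul_of_nonneg_left (by exact_mod_cast hhM) hqx0.le
      have h2 : q * (x * (M₁ : ℝ)) ≤ q * ∑ h ∈ Finset.range (M₁ + 1), (h : ℝ) * μ₁ h := mul_le_mul_of_nonneg_left hta1 hq0.le
      linarith
  · -- the plain factor: DEC at floor `x` (gate `1`), lowered to floor `q·x`
    intro j'' _ _
    refine (decAt_iff_decAtT (q * x) j'' M₂ μ₂).1 ?_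
    by_cases hj'' : j'' < M₂
    · have h := hS2 1 one_pos le_rfl j'' hj''
      rw [gate_one, one_mul] at h
      exact decAt_mono_floor hqxx hx1 h
    · refine decAt_of_top_le M₂ μ₂ h20 h2M h21 (q * x) hqx1 (fun h hh => ?_) j'' (not_lt.1 hj'')
      have hhM : h ≤ M₂ := by
        by_contra hc
        exact absurd (h2M h (not_le.1 hc)) (ne_of_gt hh)
      have h1 : q * x * (h : ℝ) ≤ q * x * (M₂ : ℝ) := mul_le_mul_of_nonneg_left (by exact_mod_cast hhM) hqx0.le
      have h2 : q * x * (M₂ : ℝ) ≤ x * (M₂ : ℝ) := mul_le_mul_of_nonneg_right hqxx (Nat.cast_nonneg _)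
      linarith

/-- **(I) ∧ (II) ∧ GM ⟹ `SDECConvClosed`.** [this work] -/
theorem sdecConvClosed_of_two_gateMove (hI : WindowAtomDecomposition) (hII : ConvClosedTResidue) (hG : GateMove) : SDECConvClosed :=
  sdecConvClosed_of_convClosedT_of_gateMove (convClosedT_of_two hI hII) hG

/-- **(I) ∧ (II) ∧ GM ⟹ `TreeBuiltDEC`.** [this work] -/
theorem treeBuiltDEC_of_two_gateMove (hI : WindowAtomDecomposition) (hII : ConvClosedTResidue) (hG : GateMove) : TreeBuiltDEC :=
  treeBuiltDEC_of_sdecConvClosed (sdecConvClosed_of_two_gateMove hI hII hG)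

end LawDec

/-- **(I) ∧ (II) ∧ GM ⟹ `Quant.TreeDEC`.** [this work] -/
theorem treeDEC_of_two_gateMove (hI : LawDec.WindowAtomDecomposition) (hII : LawDec.ConvClosedTResidue) (hG : LawDec.GateMove) :
    TreeDEC :=
  treeDEC_of_sdecConvClosed (LawDec.sdecConvClosed_of_two_gateMove hI hII hG)

/-- **(I) ∧ (II) ∧ GM ⟹ `Quant.FarTreeRow`** — FAR on trees from the two convolution statements and the gate move.  CONDITIONAL result; all
three hypotheses are `@[conjecture]`s. [this work] -/
theorem farTreeRow_of_two_gateMove (hI : LawDec.WindowAtomDecomposition) (hII : LawDec.ConvClosedTResidue) (hG : LawDec.GateMove) :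
    FarTreeRow :=
  farTreeRow_of_sdecConvClosed (LawDec.sdecConvClosed_of_two_gateMove hI hII hG)

/-! ### Appendix (typer g26): the converse — given the factors' SDEC, `SDECConvClosed` implies the gate move trivially -/

/-- **`SDECConvClosed ⟹ GateMove`**: the convolution of two SDEC factors is SDEC, so its gate by `q` is DEC(j) at its mean — the conclusion of
the move, whatever the hypothesis on `(gate_q μ₁) ∗ μ₂`.  With `sdecConvClosed_of_convClosedT_of_gateMove`: given `ConvClosedT`, `GateMove ⟺
SDECConvClosed`.  EVIDENCE UPDATE for `GateMove` (kit j159036, exact extreme rays, attached to the item): 16.4 M ray tests / 0 with `μ₂` DEC at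
every layer (M₁ ≤ 9, M₂ ≤ 10); blob factors 17.4 M / 0; cross-layer form of Conjecture E 4.2 M / 0. [this work] -/
theorem LawDec.gateMove_of_sdecConvClosed (hS : LawDec.SDECConvClosed) : LawDec.GateMove := by
  intro x q M₁ M₂ j μ₁ μ₂ hx0 hx1 hq0 hq1 h10 h1M h11 hta1 h20 h2M h21 hta2 hS1 hS2 hj _
  have h := hS x M₁ M₂ μ₁ μ₂ hx0 hx1 h10 h1M h11 hta1 h20 h2M h21 hta2 hS1 hS2 q hq0 hq1 j hj
  rw [LawDec.decAt_iff_decAtT, LawDec.sum_mul_gate, LawDec.sum_mul_lconv M₁ M₂ μ₁ μ₂ h11 h21] at h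
  exact h

end Quant

end Summit.CriticalPhenomena.PercolationContinuityZ3.Theorems
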